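import Mathlib
import HarnessLib
import Summits.HubbardSuperconductivity.HubbardSuperconductivity.Theorems.KLProgrammeKLRegimeEngineScaleZeroKernelNormsWt
import Summits.HubbardSuperconductivity.HubbardSuperconductivity.Theorems.KLProgrammeKLRegimeEngineTowerModelDefsRate

/-!
# KL programme — K3 VL child (stmt-HubbardSuperconductivity-23356), atom `stub_vl_HE1free`, LEVEL 0: the WEIGHTED kernel profile of the action at an
# ARBITRARY cutoff `Λ` analysed by the scale-`0` family `E(F_0)`, from ONE decay-weighted determinant-bounded step (modulo the three weighted sizes)
# — the cutoff-generic twin of p3 g8's `…EngineScaleZeroKernelNormsWt` in the rate-decoupled currency `klWtPinnedSumAt … 0 0 m 𝒱 q w`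

Cell gate-hubbard-kl, seat p3 (g20); VL lead k3c4-p1 g18, memo `HOME/hubbard-kl-k3c4-p1/HE1-GRANULARITY-g18.md` §2″ («(VL)-HE1-LEVEL0»).
`stub_vl_HE1free` reads, at level `j = 0`, `klWtPinnedSumAt L M β μ K 0 0 m (klEffectiveAction … K klE0 1) q w` — the weighted pinned sums of
`𝒱_1[K] = hubbardEffectiveActionCT … K Λ₁ = effAction C^K_{>Λ₁} (map (toLin' S) (V_N + 𝒩_{K,N}))` (`hubbardEffectiveActionCT_eq_effAction_gridSub`,
ANY cutoff `Λ`) analysed by `E₀ = sectorAnalysisMatrix β (klAnisoFamily … klE0 0)` with the rate-`0` tree weight.  p3 g8 proved exactly this at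
`Λ = e₀` in the currency `klWtPinnedSum … K 0 m q w` (`𝒱⁽⁰⁾`); here the covariance cutoff is a free parameter `Λ` and the action is
`hubbardEffectiveActionCT … K Λ` — the proofs are VERBATIM g8's (the step theorems never looked at the cutoff), modulo the same three weighted
sizes now AT `Λ`:

1. (α_w) `gridLabelWt`-pair-weighted row / column sums of `Sᵀ C^K_{>Λ} S` (at `Λ₁`: p3 g20 «(VL)-HE1-LEVEL0» F4–F5);
2. (cr_w / cc_w) the same for the cross-grid overlap kernel `E₀ S` (scale-`0` family; unchanged from the (E4)₀ package);
3. the smallness `θ_w = e·α_w·‖Ṽ‖_{h,wt}/κ² < 1` for the explicit weighted profile of the grid vertex, `κ` the replica Gram constant of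
   `Sᵀ C^K_{>Λ} S` (at `Λ₁`: `isGramBoundedR_scaleOneCutoff_of_frameOK`, p3 g20 F1).

* `hubbardEffectiveActionCT_eq_effAction_gridSub` — `𝒱[K]_Λ = effAction C^K_{>Λ} (map (toLin' S) (V_N + 𝒩_{K,N}))` on the `N = 4M` grid (`β ≠ 0`);
* `map_sectorAnalysis_hubbardEffectiveActionCT_mem_evenPart`, `klWtPinnedSumAt_cutoff_eq_zero_of_odd` — odd degrees carry nothing;
* **`klWtPinnedSumAt_cutoff_le_of_wgridStep`** — degrees `2p ≥ 4`, BI-GRADED (`U^{p-1}`-shaped):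
  `≤ ε_x^{2p-1}·cr_w·cc_w^{2p-1}·(ρ^{-2p}·e f₂·(eα_w f₂/κ²)^{p-2}/(1-θ_w)^p)`, `f₂ = (e²(κ+ρ))⁴·|U||β|/(4M)`;
* **`klWtPinnedSumAt_cutoff_le_of_wgridStep_full`** — every degree `m ≥ 1`: `≤ ε_x^{m-1}·cr_w·cc_w^{m-1}·(ρ^{-m}·e‖Ṽ‖_{h,wt}/(1-θ_w))`;
* **`kernelNormsWtAt_cutoff_of_wgridStep`** — for any degree budget `N` dominating these: `∀ m q w, klWtPinnedSumAt … 0 0 m 𝒱[K]_Λ q w ≤ N m`;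
* `klWtPinnedSumAt_klEffectiveAction_le_of_wgridStep` — the same stated for `klEffectiveAction … K klE0 n` (cutoff `Λ_n`), the literal
  carrier of HE1free's level-`0` clause at `n = 1`.

Everything is proved; no definitions, no named facts, no sorry.  References: BGM 2006 (2.13)–(2.14), (2.77)–(2.80), §3 (3.2)–(3.8)
[cite: BenfattoGiulianiMastropietro2006]; Pedra–Salmhofer 2008 Thm 2.4 [cite: PedraSalmhofer2008].  `--supports stmt-HubbardSuperconductivity-23356`.
-/

noncomputable section

namespace Summit.HubbardSuperconductivity.HubbardSuperconductivity.Theorems.EngineV8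

set_option linter.dupNamespace false -- summit = problem name (single-conjunct summit), D-0017

open Real Finset Literature.MathematicalPhysics.QuantumLattice Literature.Probability.LatticeModels
open Literature.Probability.LatticeModels.BattleFederbush
open Literature.MathematicalPhysics.QuantumLattice.GrassmannAlgebra
open Summit.HubbardSuperconductivity.HubbardSuperconductivity.Theorems.KLRegimeSplit
open Summit.HubbardSuperconductivity.HubbardSuperconductivity.Theorems.DispersionFlow
open Summit.HubbardSuperconductivity.HubbardSuperconductivity.Theorems.KLProgrammeLegKernels

variable {L M : ℕ} [NeZero L]

/-! ## §1 The action at cutoff `Λ` is one Gaussian step on the `4M` grid; parity -/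

/-- **`𝒱[K]_Λ = effAction C^K_{>Λ} (map (toLin' S) (V_N + 𝒩_{K,N}))`** on the `N = 4M` time grid (`β ≠ 0`): the countertermed interaction is the
grid interaction plus the grid counter-quadratic pushed forward by the grid substitution. [cite: BenfattoGiulianiMastropietro2006, §2.3 (2.23)] -/
theorem hubbardEffectiveActionCT_eq_effAction_gridSub [NeZero M] {β : ℝ} (hβ : β ≠ 0) (U μ : ℝ) (K : TrigPolyC4v) (Λ : ℝ) :
    hubbardEffectiveActionCT L M β U μ 0 K Λ =
      effAction ℂ (hubbardCovAboveCT L M β μ 0 K Λ)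
        (ExteriorAlgebra.map (Matrix.toLin' (hubbardGridSub L M β (2 * (2 * M))))
          (hubbardGridInteraction L (2 * (2 * M)) β U + hubbardGridCounterQuadratic L (2 * (2 * M)) β K)) := by
  haveI : NeZero (2 * (2 * M)) := ⟨by have := NeZero.ne M; omega⟩
  rw [hubbardEffectiveActionCT, hubbardInteractionCT, map_add,
    map_hubbardGridSub_gridInteraction hβ U (by omega), map_hubbardGridSub_gridCounterQuadratic hβ K (by omega)]

/-- **The analysed action `map (toLin' E₀) 𝒱[K]_Λ` is even** (`β ≠ 0`). -/
theorem map_sectorAnalysis_hubbardEffectiveActionCT_mem_evenPart [NeZero M] {β : ℝ} (hβ : β ≠ 0) (U μ : ℝ) (K : TrigPolyC4v) (Λ : ℝ) :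
    ExteriorAlgebra.map (Matrix.toLin' (sectorAnalysisMatrix L M β (klAnisoFamily L M β μ K klE0 0)))
        (hubbardEffectiveActionCT L M β U μ 0 K Λ) ∈
      evenPart ℂ (SpaceTimeIdx L M × SectorLeg (sectorCount 0)) := by
  haveI : NeZero (2 * (2 * M)) := ⟨by have := NeZero.ne M; omega⟩
  rw [hubbardEffectiveActionCT_eq_effAction_gridSub hβ U μ K Λ]
  set Vt := hubbardGridInteraction L (2 * (2 * M)) β U + hubbardGridCounterQuadratic L (2 * (2 * M)) β K with hVt
  have hVt_even : Vt ∈ evenPart ℂ (GridLeg (GridPoint L (2 * (2 * M)))) :=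
    add_mem (hubbardGridInteraction_mem_evenPart β U) (hubbardGridCounterQuadratic_mem_evenPart β K)
  have hVt0 : constPart ℂ Vt = 0 := by
    rw [hVt, map_add, constPart_hubbardGridInteraction, constPart_hubbardGridCounterQuadratic, add_zero]
  have hSV : ExteriorAlgebra.map (Matrix.toLin' (hubbardGridSub L M β (2 * (2 * M)))) Vt ∈ evenPart ℂ (HubbardFieldIdx L M) :=
    mem_evenPart_iff.2 (map_mem_evenOdd_zero ℂ _ (mem_evenPart_iff.1 hVt_even))
  have hSV0 : constPart ℂ (ExteriorAlgebra.map (Matrix.toLin' (hubbardGridSub L M β (2 * (2 * M)))) Vt) = 0 := by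
    rw [constPart_map, hVt0]
  exact mem_evenPart_iff.2 (map_mem_evenOdd_zero ℂ _ (mem_evenPart_iff.1 (effAction_mem_evenPart _ hSV hSV0)))

/-- **Odd degrees carry nothing**: `klWtPinnedSumAt … 0 0 m 𝒱[K]_Λ q w = 0` for odd `m` (`β ≠ 0`). -/
theorem klWtPinnedSumAt_cutoff_eq_zero_of_odd [NeZero M] {β : ℝ} (hβ : β ≠ 0) (U μ : ℝ) (K : TrigPolyC4v) (Λ : ℝ) {m : ℕ} (hm : Odd m)
    (q : Fin m) (w : SpaceTimeIdx L M × SectorLeg (sectorCount 0)) :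
    klWtPinnedSumAt L M β μ K 0 0 m (hubbardEffectiveActionCT L M β U μ 0 K Λ) q w = 0 := by
  rw [klWtPinnedSumAt]
  refine mul_eq_zero_of_right _ (sum_eq_zero fun X _ => ?_)
  rw [kernel_eq_zero_of_mem_evenPart_of_odd ℂ (map_sectorAnalysis_hubbardEffectiveActionCT_mem_evenPart hβ U μ K Λ) hm X, norm_zero,
    mul_zero]

/-! ## §3 Degrees `2p ≥ 4`: the bi-graded weighted step read through `E₀S` -/

/-- **(E1-W)₀ in degrees `2p ≥ 4` from ONE decay-weighted bi-graded determinant-bounded step** (modulo the three weighted sizes).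
`S = hubbardGridSub … (4M)`, `C₀ = C^K_{>e₀}`, `E₀ = sectorAnalysisMatrix β (klAnisoFamily … klE0 0)`, `wt = gridLabelWt L (4M) β`:
if `SᵀC₀S` is replica-Gram-bounded (`κ`) with `wt`-pair-weighted row / column sums `≤ α_w`, `θ_w = e·α_w·‖Ṽ‖_{h,wt}/κ² < 1` for the weighted
profile of the grid vertex and a weight `ρ > 0`, and `E₀S` has `wt`-pair-weighted row / column sums `≤ cr_w / cc_w`, then for every `p ≥ 2`,
pinned leg `q` and field index `w`:
`klWtPinnedSum … K 0 (2p) q w ≤ ε_x^{2p-1}·cr_w·cc_w^{2p-1}·(ρ^{-2p}·e f₂·(eα_w f₂/κ²)^{p-2}/(1-θ_w)^p)`, `f₂ = (e²(κ+ρ))⁴·|U||β|/(4M)`. -/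
theorem klWtPinnedSumAt_cutoff_le_of_wgridStep [NeZero M] {β : ℝ} (hβ : 0 < β) (U μ : ℝ) (K : TrigPolyC4v) (Λ : ℝ)
    {κ : ℝ} (hκ : 0 < κ)
    (hGB : IsGramBoundedR ((hubbardGridSub L M β (2 * (2 * M))).transpose * hubbardCovAboveCT L M β μ 0 K Λ *
      hubbardGridSub L M β (2 * (2 * M))) κ)
    {αw : ℝ} (hαw : 0 < αw)
    (hrow : ∀ X, ∑ Y, ‖((hubbardGridSub L M β (2 * (2 * M))).transpose * hubbardCovAboveCT L M β μ 0 K Λ *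
      hubbardGridSub L M β (2 * (2 * M))) X Y‖ * gridLabelWt L (2 * (2 * M)) β {gridLegPos X, gridLegPos Y} ≤ αw)
    (hcol : ∀ Y, ∑ X, ‖((hubbardGridSub L M β (2 * (2 * M))).transpose * hubbardCovAboveCT L M β μ 0 K Λ *
      hubbardGridSub L M β (2 * (2 * M))) X Y‖ * gridLabelWt L (2 * (2 * M)) β {gridLegPos X, gridLegPos Y} ≤ αw)
    {ρ : ℝ} (hρ : 0 < ρ)
    (hθ : Real.exp 1 * αw * normV (GridLeg (GridPoint L (2 * (2 * M)))) κ ρ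
      (fun m' : ℕ => if m' = 1 then |β| / (2 * (2 * M) : ℕ) * ∑ z : TorusSite 2 L, ‖framePosKernel L K z‖ * (1 + torusSiteDist z 0)
        else if m' = 2 then |U| * |β| / (2 * (2 * M) : ℕ) else 0) / κ ^ 2 < 1)
    {crw ccw : ℝ} (hccw0 : 0 ≤ ccw)
    (hrow' : ∀ X'' : SpaceTimeIdx L M × SectorLeg (sectorCount 0), ∑ X' : GridLeg (GridPoint L (2 * (2 * M))),
      ‖(sectorAnalysisMatrix L M β (klAnisoFamily L M β μ K klE0 0) * hubbardGridSub L M β (2 * (2 * M))) X'' X'‖ *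
        gridLabelWt L (2 * (2 * M)) β {latticeLegPos (2 * (2 * M)) X'', gridLegPos X'} ≤ crw)
    (hcol' : ∀ X' : GridLeg (GridPoint L (2 * (2 * M))), ∑ X'' : SpaceTimeIdx L M × SectorLeg (sectorCount 0),
      ‖(sectorAnalysisMatrix L M β (klAnisoFamily L M β μ K klE0 0) * hubbardGridSub L M β (2 * (2 * M))) X'' X'‖ *
        gridLabelWt L (2 * (2 * M)) β {latticeLegPos (2 * (2 * M)) X'', gridLegPos X'} ≤ ccw)
    {p : ℕ} (hp : 2 ≤ p) (q : Fin (2 * p)) (w : SpaceTimeIdx L M × SectorLeg (sectorCount 0)) :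
    klWtPinnedSumAt L M β μ K 0 0 (2 * p) (hubbardEffectiveActionCT L M β U μ 0 K Λ) q w ≤
      imagTimeWeight β M ^ (2 * p - 1) *
        (crw * ccw ^ (2 * p - 1) *
          (ρ⁻¹ ^ (2 * p) * (Real.exp 1 * ((Real.exp 2 * (κ + ρ)) ^ (2 * 2) * (|U| * |β| / (2 * (2 * M) : ℕ)))) *
            (Real.exp 1 * αw * ((Real.exp 2 * (κ + ρ)) ^ (2 * 2) * (|U| * |β| / (2 * (2 * M) : ℕ))) / κ ^ 2) ^ (p - 2) /
              (1 - Real.exp 1 * αw * normV (GridLeg (GridPoint L (2 * (2 * M)))) κ ρ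
                (fun m' : ℕ => if m' = 1 then |β| / (2 * (2 * M) : ℕ) * ∑ z : TorusSite 2 L, ‖framePosKernel L K z‖ * (1 + torusSiteDist z 0)
                  else if m' = 2 then |U| * |β| / (2 * (2 * M) : ℕ) else 0) / κ ^ 2) ^ p)) := by
  -- notation
  set Ng : ℕ := 2 * (2 * M) with hNg
  haveI : NeZero Ng := ⟨by rw [hNg]; have := NeZero.ne M; omega⟩
  set S := hubbardGridSub L M β Ng with hS
  set C₀ := hubbardCovAboveCT L M β μ 0 K Λ with hC₀
  set F₀ := klAnisoFamily L M β μ K klE0 0 with hF₀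
  set E₀ := sectorAnalysisMatrix L M β F₀ with hE₀
  set Vt := hubbardGridInteraction L Ng β U + hubbardGridCounterQuadratic L Ng β K with hVt
  set wt := gridLabelWt L Ng β with hwt
  set Nw : ℕ → ℝ := fun m' : ℕ => if m' = 1 then |β| / Ng * ∑ z : TorusSite 2 L, ‖framePosKernel L K z‖ * (1 + torusSiteDist z 0)
    else if m' = 2 then |U| * |β| / Ng else 0 with hNw
  have hwtree : IsTreeWeight wt := isTreeWeight_gridLabelWt L Ng hβ.le
  have hfS : LinearMap.toMatrix' (Matrix.toLin' S) = S := LinearMap.toMatrix'_toLin' S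
  have hgE : LinearMap.toMatrix' (Matrix.toLin' E₀) = E₀ := LinearMap.toMatrix'_toLin' E₀
  have hVt_even : Vt ∈ evenPart ℂ (GridLeg (GridPoint L Ng)) :=
    add_mem (hubbardGridInteraction_mem_evenPart β U) (hubbardGridCounterQuadratic_mem_evenPart β K)
  have hVt0 : constPart ℂ Vt = 0 := by
    rw [hVt, map_add, constPart_hubbardGridInteraction, constPart_hubbardGridCounterQuadratic, add_zero]
  have hNw2 : ∀ m', 2 < m' → Nw m' = 0 := fun m' hm' => by
    rw [hNw]; dsimp only; rw [if_neg (by omega), if_neg (by omega)]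
  -- (1) the weighted bi-graded step, output degree `2p`, leg `q` pinned at `w`
  have hstep := (sum_wt_norm_kernel_map_effAction_le_biquartic_of_gramBounded hwtree gridLegPos (latticeLegPos Ng) C₀ (Matrix.toLin' S)
    (Matrix.toLin' E₀) Vt hVt_even hVt0 Nw (scaleZeroPinnedW_nonneg β U K)
    (fun m' j w => sum_norm_kernel_gridVertex_mul_wt_le β U hβ.le K m' j w) hNw2 hκ (by rw [hfS]; exact hGB) hαw
    (by rw [hfS]; exact hrow) (by rw [hfS]; exact hcol) hρ hθ hccw0
    (fun X'' => by rw [hfS, hgE]; exact hrow' X'') (fun X' => by rw [hfS, hgE]; exact hcol' X') hp q w).2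
  -- (2) the pinned sum in `klWtPinnedSum` currency: the action is the analysed step, the weight is dominated by `wt`
  rw [klWtPinnedSumAt, hubbardEffectiveActionCT_eq_effAction_gridSub hβ.ne' U μ K Λ]
  refine mul_le_mul_of_nonneg_left ?_ (pow_nonneg (imagTimeWeight_nonneg hβ.le M) _)
  refine le_trans (sum_le_sum fun X _ => ?_) hstep
  exact mul_le_mul_of_nonneg_right (klScaleWt_zero_le_gridLabelWt β _) (norm_nonneg _)

/-! ## §4 Every positive degree: the full weighted step read through `E₀S` -/

/-- **(E1-W)₀ in every degree `m ≥ 1` from the FULL decay-weighted determinant-bounded step** (same three weighted sizes; used at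
`m = 2`, where the kernel of `𝒱⁽⁰⁾` contains the counterterm and the tadpole):
`klWtPinnedSum … K 0 m q w ≤ ε_x^{m-1}·cr_w·cc_w^{m-1}·(ρ^{-m}·e‖Ṽ‖_{h,wt}/(1-θ_w))`, `‖Ṽ‖_{h,wt} = normV κ ρ N_w`. -/
theorem klWtPinnedSumAt_cutoff_le_of_wgridStep_full [NeZero M] {β : ℝ} (hβ : 0 < β) (U μ : ℝ) (K : TrigPolyC4v) (Λ : ℝ)
    {κ : ℝ} (hκ : 0 < κ)
    (hGB : IsGramBoundedR ((hubbardGridSub L M β (2 * (2 * M))).transpose * hubbardCovAboveCT L M β μ 0 K Λ *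
      hubbardGridSub L M β (2 * (2 * M))) κ)
    {αw : ℝ} (hαw : 0 < αw)
    (hrow : ∀ X, ∑ Y, ‖((hubbardGridSub L M β (2 * (2 * M))).transpose * hubbardCovAboveCT L M β μ 0 K Λ *
      hubbardGridSub L M β (2 * (2 * M))) X Y‖ * gridLabelWt L (2 * (2 * M)) β {gridLegPos X, gridLegPos Y} ≤ αw)
    (hcol : ∀ Y, ∑ X, ‖((hubbardGridSub L M β (2 * (2 * M))).transpose * hubbardCovAboveCT L M β μ 0 K Λ *
      hubbardGridSub L M β (2 * (2 * M))) X Y‖ * gridLabelWt L (2 * (2 * M)) β {gridLegPos X, gridLegPos Y} ≤ αw)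
    {ρ : ℝ} (hρ : 0 < ρ)
    (hθ : Real.exp 1 * αw * normV (GridLeg (GridPoint L (2 * (2 * M)))) κ ρ
      (fun m' : ℕ => if m' = 1 then |β| / (2 * (2 * M) : ℕ) * ∑ z : TorusSite 2 L, ‖framePosKernel L K z‖ * (1 + torusSiteDist z 0)
        else if m' = 2 then |U| * |β| / (2 * (2 * M) : ℕ) else 0) / κ ^ 2 < 1)
    {crw ccw : ℝ} (hccw0 : 0 ≤ ccw)
    (hrow' : ∀ X'' : SpaceTimeIdx L M × SectorLeg (sectorCount 0), ∑ X' : GridLeg (GridPoint L (2 * (2 * M))),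
      ‖(sectorAnalysisMatrix L M β (klAnisoFamily L M β μ K klE0 0) * hubbardGridSub L M β (2 * (2 * M))) X'' X'‖ *
        gridLabelWt L (2 * (2 * M)) β {latticeLegPos (2 * (2 * M)) X'', gridLegPos X'} ≤ crw)
    (hcol' : ∀ X' : GridLeg (GridPoint L (2 * (2 * M))), ∑ X'' : SpaceTimeIdx L M × SectorLeg (sectorCount 0),
      ‖(sectorAnalysisMatrix L M β (klAnisoFamily L M β μ K klE0 0) * hubbardGridSub L M β (2 * (2 * M))) X'' X'‖ *
        gridLabelWt L (2 * (2 * M)) β {latticeLegPos (2 * (2 * M)) X'', gridLegPos X'} ≤ ccw)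
    {m : ℕ} (hm : 0 < m) (q : Fin m) (w : SpaceTimeIdx L M × SectorLeg (sectorCount 0)) :
    klWtPinnedSumAt L M β μ K 0 0 m (hubbardEffectiveActionCT L M β U μ 0 K Λ) q w ≤
      imagTimeWeight β M ^ (m - 1) *
        (crw * ccw ^ (m - 1) *
          (ρ⁻¹ ^ m * (Real.exp 1 * normV (GridLeg (GridPoint L (2 * (2 * M)))) κ ρ
              (fun m' : ℕ => if m' = 1 then |β| / (2 * (2 * M) : ℕ) * ∑ z : TorusSite 2 L, ‖framePosKernel L K z‖ * (1 + torusSiteDist z 0)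
                else if m' = 2 then |U| * |β| / (2 * (2 * M) : ℕ) else 0)) /
            (1 - Real.exp 1 * αw * normV (GridLeg (GridPoint L (2 * (2 * M)))) κ ρ
              (fun m' : ℕ => if m' = 1 then |β| / (2 * (2 * M) : ℕ) * ∑ z : TorusSite 2 L, ‖framePosKernel L K z‖ * (1 + torusSiteDist z 0)
                else if m' = 2 then |U| * |β| / (2 * (2 * M) : ℕ) else 0) / κ ^ 2))) := by
  -- notation
  set Ng : ℕ := 2 * (2 * M) with hNg
  haveI : NeZero Ng := ⟨by rw [hNg]; have := NeZero.ne M; omega⟩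
  set S := hubbardGridSub L M β Ng with hS
  set C₀ := hubbardCovAboveCT L M β μ 0 K Λ with hC₀
  set C' := S.transpose * C₀ * S with hC'
  set F₀ := klAnisoFamily L M β μ K klE0 0 with hF₀
  set E₀ := sectorAnalysisMatrix L M β F₀ with hE₀
  set Vt := hubbardGridInteraction L Ng β U + hubbardGridCounterQuadratic L Ng β K with hVt
  set wt := gridLabelWt L Ng β with hwt
  set Nw : ℕ → ℝ := fun m' : ℕ => if m' = 1 then |β| / Ng * ∑ z : TorusSite 2 L, ‖framePosKernel L K z‖ * (1 + torusSiteDist z 0)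
    else if m' = 2 then |U| * |β| / Ng else 0 with hNw
  have hwtree : IsTreeWeight wt := isTreeWeight_gridLabelWt L Ng hβ.le
  -- the weight pulled back to the grid legs
  have hwt' : IsTreeWeight (fun T : Finset (GridLeg (GridPoint L Ng)) => wt (T.image gridLegPos)) := hwtree.comap gridLegPos
  have hpair : ∀ X Y : GridLeg (GridPoint L Ng), (fun T : Finset (GridLeg (GridPoint L Ng)) => wt (T.image gridLegPos)) {X, Y} =
      wt {gridLegPos X, gridLegPos Y} := fun X Y => by simp only [image_insert, image_singleton]
  have hfS : LinearMap.toMatrix' (Matrix.toLin' S) = S := LinearMap.toMatrix'_toLin' S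
  have hgE : LinearMap.toMatrix' (Matrix.toLin' E₀) = E₀ := LinearMap.toMatrix'_toLin' E₀
  have hVt_even : Vt ∈ evenPart ℂ (GridLeg (GridPoint L Ng)) :=
    add_mem (hubbardGridInteraction_mem_evenPart β U) (hubbardGridCounterQuadratic_mem_evenPart β K)
  have hVt0 : constPart ℂ Vt = 0 := by
    rw [hVt, map_add, constPart_hubbardGridInteraction, constPart_hubbardGridCounterQuadratic, add_zero]
  -- (1) the full weighted step on the grid with covariance `C' = SᵀC₀S`
  obtain ⟨-, hfull⟩ := sum_wt_norm_kernel_effAction_le_of_gramBounded C' hwt' hκ hGB Vt hVt_even hVt0 Nw (scaleZeroPinnedW_nonneg β U K)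
    (fun m' j w => sum_norm_kernel_gridVertex_mul_wt_le β U hβ.le K m' j w) hαw
    (fun X => by simp only [hpair]; exact hrow X) (fun Y => by simp only [hpair]; exact hcol Y) hρ hθ
  have hθle : 0 ≤ 1 - Real.exp 1 * αw * normV (GridLeg (GridPoint L Ng)) κ ρ Nw / κ ^ 2 := sub_nonneg.2 hθ.le
  have hB0 : 0 ≤ ρ⁻¹ ^ m * (Real.exp 1 * normV (GridLeg (GridPoint L Ng)) κ ρ Nw) /
      (1 - Real.exp 1 * αw * normV (GridLeg (GridPoint L Ng)) κ ρ Nw / κ ^ 2) :=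
    div_nonneg (mul_nonneg (pow_nonneg (inv_nonneg.2 hρ.le) _)
      (mul_nonneg (Real.exp_pos 1).le (normV_nonneg hκ.le hρ.le (scaleZeroPinnedW_nonneg β U K)))) hθle
  have hfull' : ∀ (q' : Fin m) (x : GridLeg (GridPoint L Ng)),
      ∑ X ∈ univ.filter (fun X : Fin m → GridLeg (GridPoint L Ng) => X q' = x),
        ‖kernel ℂ (effAction ℂ C' Vt) m X‖ * wt ((univ.image X).image gridLegPos) ≤
          ρ⁻¹ ^ m * (Real.exp 1 * normV (GridLeg (GridPoint L Ng)) κ ρ Nw) /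
            (1 - Real.exp 1 * αw * normV (GridLeg (GridPoint L Ng)) κ ρ Nw / κ ^ 2) := by
    intro q' x
    exact (le_of_eq (sum_congr rfl fun X _ => mul_comm _ _)).trans (hfull hm q' x)
  -- (2) read through `E₀S` by the weighted Young step
  have hyoung := sum_filter_wt_norm_kernel_map_le_of_pos hwtree gridLegPos (latticeLegPos Ng)
    ((Matrix.toLin' E₀) ∘ₗ (Matrix.toLin' S)) hccw0
    (by intro X''; rw [LinearMap.toMatrix'_comp, hfS, hgE]; exact hrow' X'')
    (by intro X'; rw [LinearMap.toMatrix'_comp, hfS, hgE]; exact hcol' X') (effAction ℂ C' Vt) hm hB0 hfull' q w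
  -- (3) the pinned sum in `klWtPinnedSum` currency
  rw [klWtPinnedSumAt, hubbardEffectiveActionCT_eq_effAction_gridSub hβ.ne' U μ K Λ]
  refine mul_le_mul_of_nonneg_left ?_ (pow_nonneg (imagTimeWeight_nonneg hβ.le M) _)
  have hrepr : ExteriorAlgebra.map (Matrix.toLin' E₀) (effAction ℂ C₀ (ExteriorAlgebra.map (Matrix.toLin' S) Vt)) =
      ExteriorAlgebra.map ((Matrix.toLin' E₀) ∘ₗ (Matrix.toLin' S)) (effAction ℂ C' Vt) := by
    rw [effAction_map, hfS, map_map_eq_map_comp]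
  rw [hrepr]
  refine le_trans (sum_le_sum fun X _ => ?_) hyoung
  exact mul_le_mul_of_nonneg_right (klScaleWt_zero_le_gridLabelWt β _) (norm_nonneg _)

/-! ## §5 The assembly: `KernelNormsWt … K 0` for any budget dominating the two bounds -/

/-- **(E1-W)₀ — `KernelNormsWt L M N β U μ K 0` from ONE weighted determinant-bounded step, for ANY degree budget `N` dominating the
bi-graded bound in degrees `2p ≥ 4`, the full-step bound in degree `2`, and `0` in odd degrees** (modulo the three weighted sizes
α_w, cr_w/cc_w, θ_w < 1 — the same as (E4)₀'s `firstMoment_zero_le_of_wgridStep`). -/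
theorem kernelNormsWtAt_cutoff_of_wgridStep [NeZero M] {β : ℝ} (hβ : 0 < β) (U μ : ℝ) (K : TrigPolyC4v) (Λ : ℝ)
    {κ : ℝ} (hκ : 0 < κ)
    (hGB : IsGramBoundedR ((hubbardGridSub L M β (2 * (2 * M))).transpose * hubbardCovAboveCT L M β μ 0 K Λ *
      hubbardGridSub L M β (2 * (2 * M))) κ)
    {αw : ℝ} (hαw : 0 < αw)
    (hrow : ∀ X, ∑ Y, ‖((hubbardGridSub L M β (2 * (2 * M))).transpose * hubbardCovAboveCT L M β μ 0 K Λ *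
      hubbardGridSub L M β (2 * (2 * M))) X Y‖ * gridLabelWt L (2 * (2 * M)) β {gridLegPos X, gridLegPos Y} ≤ αw)
    (hcol : ∀ Y, ∑ X, ‖((hubbardGridSub L M β (2 * (2 * M))).transpose * hubbardCovAboveCT L M β μ 0 K Λ *
      hubbardGridSub L M β (2 * (2 * M))) X Y‖ * gridLabelWt L (2 * (2 * M)) β {gridLegPos X, gridLegPos Y} ≤ αw)
    {ρ : ℝ} (hρ : 0 < ρ)
    (hθ : Real.exp 1 * αw * normV (GridLeg (GridPoint L (2 * (2 * M)))) κ ρ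
      (fun m' : ℕ => if m' = 1 then |β| / (2 * (2 * M) : ℕ) * ∑ z : TorusSite 2 L, ‖framePosKernel L K z‖ * (1 + torusSiteDist z 0)
        else if m' = 2 then |U| * |β| / (2 * (2 * M) : ℕ) else 0) / κ ^ 2 < 1)
    {crw ccw : ℝ} (hccw0 : 0 ≤ ccw)
    (hrow' : ∀ X'' : SpaceTimeIdx L M × SectorLeg (sectorCount 0), ∑ X' : GridLeg (GridPoint L (2 * (2 * M))),
      ‖(sectorAnalysisMatrix L M β (klAnisoFamily L M β μ K klE0 0) * hubbardGridSub L M β (2 * (2 * M))) X'' X'‖ *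
        gridLabelWt L (2 * (2 * M)) β {latticeLegPos (2 * (2 * M)) X'', gridLegPos X'} ≤ crw)
    (hcol' : ∀ X' : GridLeg (GridPoint L (2 * (2 * M))), ∑ X'' : SpaceTimeIdx L M × SectorLeg (sectorCount 0),
      ‖(sectorAnalysisMatrix L M β (klAnisoFamily L M β μ K klE0 0) * hubbardGridSub L M β (2 * (2 * M))) X'' X'‖ *
        gridLabelWt L (2 * (2 * M)) β {latticeLegPos (2 * (2 * M)) X'', gridLegPos X'} ≤ ccw)
    (N : ℕ → ℝ) (hNodd : ∀ m, Odd m → 0 ≤ N m)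
    (hN2 : imagTimeWeight β M ^ (2 - 1) *
        (crw * ccw ^ (2 - 1) *
          (ρ⁻¹ ^ 2 * (Real.exp 1 * normV (GridLeg (GridPoint L (2 * (2 * M)))) κ ρ
              (fun m' : ℕ => if m' = 1 then |β| / (2 * (2 * M) : ℕ) * ∑ z : TorusSite 2 L, ‖framePosKernel L K z‖ * (1 + torusSiteDist z 0)
                else if m' = 2 then |U| * |β| / (2 * (2 * M) : ℕ) else 0)) /
            (1 - Real.exp 1 * αw * normV (GridLeg (GridPoint L (2 * (2 * M)))) κ ρ
              (fun m' : ℕ => if m' = 1 then |β| / (2 * (2 * M) : ℕ) * ∑ z : TorusSite 2 L, ‖framePosKernel L K z‖ * (1 + torusSiteDist z 0)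
                else if m' = 2 then |U| * |β| / (2 * (2 * M) : ℕ) else 0) / κ ^ 2))) ≤ N 2)
    (hNp : ∀ p, 2 ≤ p → imagTimeWeight β M ^ (2 * p - 1) *
        (crw * ccw ^ (2 * p - 1) *
          (ρ⁻¹ ^ (2 * p) * (Real.exp 1 * ((Real.exp 2 * (κ + ρ)) ^ (2 * 2) * (|U| * |β| / (2 * (2 * M) : ℕ)))) *
            (Real.exp 1 * αw * ((Real.exp 2 * (κ + ρ)) ^ (2 * 2) * (|U| * |β| / (2 * (2 * M) : ℕ))) / κ ^ 2) ^ (p - 2) /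
              (1 - Real.exp 1 * αw * normV (GridLeg (GridPoint L (2 * (2 * M)))) κ ρ
                (fun m' : ℕ => if m' = 1 then |β| / (2 * (2 * M) : ℕ) * ∑ z : TorusSite 2 L, ‖framePosKernel L K z‖ * (1 + torusSiteDist z 0)
                  else if m' = 2 then |U| * |β| / (2 * (2 * M) : ℕ) else 0) / κ ^ 2) ^ p)) ≤ N (2 * p)) :
    ∀ (m : ℕ) (q : Fin m) (w : SpaceTimeIdx L M × SectorLeg (sectorCount 0)),
      klWtPinnedSumAt L M β μ K 0 0 m (hubbardEffectiveActionCT L M β U μ 0 K Λ) q w ≤ N m := by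
  intro m q w
  rcases Nat.even_or_odd m with he | ho
  · obtain ⟨p, rfl⟩ := he
    rcases p with _ | _ | p
    · exact q.elim0
    · exact (klWtPinnedSumAt_cutoff_le_of_wgridStep_full hβ U μ K Λ hκ hGB hαw hrow hcol hρ hθ hccw0 hrow' hcol' (by norm_num) q w).trans hN2
    · revert q
      rw [← two_mul]
      intro q
      exact (klWtPinnedSumAt_cutoff_le_of_wgridStep hβ U μ K Λ hκ hGB hαw hrow hcol hρ hθ hccw0 hrow' hcol' (by omega) q w).trans
        (hNp (p + 2) (by omega))
  · rw [klWtPinnedSumAt_cutoff_eq_zero_of_odd hβ.ne' U μ K Λ ho q w]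
    exact hNodd m ho

/-- **The same door for the KL carrier `klEffectiveAction … K klE0 n = 𝒱[K]_{Λ_n}`** (cutoff `Λ_n = klScale klE0 n`; at `n = 1` this is the
level-`0` clause of `stub_vl_HE1free`, analysed by `E(F_0)` at rate `0`): for any degree budget `N` dominating the two step bounds,
`∀ m q w, klWtPinnedSumAt … 0 0 m (klEffectiveAction … K klE0 n) q w ≤ N m`. -/
theorem klWtPinnedSumAt_klEffectiveAction_le_of_wgridStep [NeZero M] {β : ℝ} (hβ : 0 < β) (U μ : ℝ) (K : TrigPolyC4v) (n : ℕ)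
    {κ : ℝ} (hκ : 0 < κ)
    (hGB : IsGramBoundedR ((hubbardGridSub L M β (2 * (2 * M))).transpose * hubbardCovAboveCT L M β μ 0 K (klScale klE0 n) *
      hubbardGridSub L M β (2 * (2 * M))) κ)
    {αw : ℝ} (hαw : 0 < αw)
    (hrow : ∀ X, ∑ Y, ‖((hubbardGridSub L M β (2 * (2 * M))).transpose * hubbardCovAboveCT L M β μ 0 K (klScale klE0 n) *
      hubbardGridSub L M β (2 * (2 * M))) X Y‖ * gridLabelWt L (2 * (2 * M)) β {gridLegPos X, gridLegPos Y} ≤ αw)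
    (hcol : ∀ Y, ∑ X, ‖((hubbardGridSub L M β (2 * (2 * M))).transpose * hubbardCovAboveCT L M β μ 0 K (klScale klE0 n) *
      hubbardGridSub L M β (2 * (2 * M))) X Y‖ * gridLabelWt L (2 * (2 * M)) β {gridLegPos X, gridLegPos Y} ≤ αw)
    {ρ : ℝ} (hρ : 0 < ρ)
    (hθ : Real.exp 1 * αw * normV (GridLeg (GridPoint L (2 * (2 * M)))) κ ρ
      (fun m' : ℕ => if m' = 1 then |β| / (2 * (2 * M) : ℕ) * ∑ z : TorusSite 2 L, ‖framePosKernel L K z‖ * (1 + torusSiteDist z 0)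
        else if m' = 2 then |U| * |β| / (2 * (2 * M) : ℕ) else 0) / κ ^ 2 < 1)
    {crw ccw : ℝ} (hccw0 : 0 ≤ ccw)
    (hrow' : ∀ X'' : SpaceTimeIdx L M × SectorLeg (sectorCount 0), ∑ X' : GridLeg (GridPoint L (2 * (2 * M))),
      ‖(sectorAnalysisMatrix L M β (klAnisoFamily L M β μ K klE0 0) * hubbardGridSub L M β (2 * (2 * M))) X'' X'‖ *
        gridLabelWt L (2 * (2 * M)) β {latticeLegPos (2 * (2 * M)) X'', gridLegPos X'} ≤ crw)
    (hcol' : ∀ X' : GridLeg (GridPoint L (2 * (2 * M))), ∑ X'' : SpaceTimeIdx L M × SectorLeg (sectorCount 0),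
      ‖(sectorAnalysisMatrix L M β (klAnisoFamily L M β μ K klE0 0) * hubbardGridSub L M β (2 * (2 * M))) X'' X'‖ *
        gridLabelWt L (2 * (2 * M)) β {latticeLegPos (2 * (2 * M)) X'', gridLegPos X'} ≤ ccw)
    (N : ℕ → ℝ) (hNodd : ∀ m, Odd m → 0 ≤ N m)
    (hN2 : imagTimeWeight β M ^ (2 - 1) *
        (crw * ccw ^ (2 - 1) *
          (ρ⁻¹ ^ 2 * (Real.exp 1 * normV (GridLeg (GridPoint L (2 * (2 * M)))) κ ρ
              (fun m' : ℕ => if m' = 1 then |β| / (2 * (2 * M) : ℕ) * ∑ z : TorusSite 2 L, ‖framePosKernel L K z‖ * (1 + torusSiteDist z 0)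
                else if m' = 2 then |U| * |β| / (2 * (2 * M) : ℕ) else 0)) /
            (1 - Real.exp 1 * αw * normV (GridLeg (GridPoint L (2 * (2 * M)))) κ ρ
              (fun m' : ℕ => if m' = 1 then |β| / (2 * (2 * M) : ℕ) * ∑ z : TorusSite 2 L, ‖framePosKernel L K z‖ * (1 + torusSiteDist z 0)
                else if m' = 2 then |U| * |β| / (2 * (2 * M) : ℕ) else 0) / κ ^ 2))) ≤ N 2)
    (hNp : ∀ p, 2 ≤ p → imagTimeWeight β M ^ (2 * p - 1) *
        (crw * ccw ^ (2 * p - 1) *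
          (ρ⁻¹ ^ (2 * p) * (Real.exp 1 * ((Real.exp 2 * (κ + ρ)) ^ (2 * 2) * (|U| * |β| / (2 * (2 * M) : ℕ)))) *
            (Real.exp 1 * αw * ((Real.exp 2 * (κ + ρ)) ^ (2 * 2) * (|U| * |β| / (2 * (2 * M) : ℕ))) / κ ^ 2) ^ (p - 2) /
              (1 - Real.exp 1 * αw * normV (GridLeg (GridPoint L (2 * (2 * M)))) κ ρ
                (fun m' : ℕ => if m' = 1 then |β| / (2 * (2 * M) : ℕ) * ∑ z : TorusSite 2 L, ‖framePosKernel L K z‖ * (1 + torusSiteDist z 0)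
                  else if m' = 2 then |U| * |β| / (2 * (2 * M) : ℕ) else 0) / κ ^ 2) ^ p)) ≤ N (2 * p)) :
    ∀ (m : ℕ) (q : Fin m) (w : SpaceTimeIdx L M × SectorLeg (sectorCount 0)),
      klWtPinnedSumAt L M β μ K 0 0 m (klEffectiveAction L M β U μ K klE0 n) q w ≤ N m :=
  fun m q w =>
  kernelNormsWtAt_cutoff_of_wgridStep hβ U μ K (klScale klE0 n) hκ hGB hαw hrow hcol hρ hθ hccw0 hrow' hcol' N hNodd hN2 hNp m q w

end Summit.HubbardSuperconductivity.HubbardSuperconductivity.Theorems.EngineV8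

end
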